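import Mathlib
import Summits.CriticalPhenomena.Ising3DConformalLimit.Theorems.PrecisionLaplacianTwoPointSpineGlueStepIntegral
import HarnessLib

/-!
# TwoPointSpineGlue (route PrecisionLaplacian, item stmt-CriticalPhenomena-4805) — the scaling limit of the
# symbol of a heavy-tailed step law

Helper file 13.  Let `q ≥ 0` be summable on `ℤ³` with the TAIL profile
`q(x)‖x‖₂^{3+α} − Ψ(x/‖x‖₂) → 0` at infinity (`0 < α < 2`, `Ψ` continuous on the unit sphere).  Then for
every `κ ∈ ℝ³` the rescaled symbol converges:

* `symbol_scaling_limit` — `N^α ∑_y q(y) (1 − cos((κ/N)·y)) → L(κ)` as `N → ∞` (through the naturals),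
  with `L(κ) = ∫_{ℝ³} Ψ(ẑ) ‖z‖₂^{-3-α} (1 − cos(κ·z)) dz`.

Proof: lattice sums are integrals of step functions (`…StepIntegral.integral_comp_floor`); the
integrands `N^{3+α} q(⌊Nz⌋)(1 − cos((κ/N)·⌊Nz⌋))` converge pointwise off the coordinate hyperplanes by
the directional transfer of `…TwoPointSpineGlueLattice` and are dominated, thanks to the upper envelope
`q(y) ≤ C‖y‖^{-3-α}` (`…HeavyBoxes.upper_of_profile`), by the integrable
`C' (𝟙_{[-π,π]³} ∏ᵢ |zᵢ|^{-(1+α)/3} + (1 + ‖z‖)^{-3-α})`; the finitely many sites of `Λ₁` contribute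
`O(N^{α-2}) → 0`.  Dominated convergence.  No definitions are introduced.
-/

noncomputable section

namespace Summit.CriticalPhenomena.Ising3DConformalLimit.Theorems.SpineGlue

open Finset Real Filter Topology MeasureTheory Literature.Probability.LatticeModels
open Summit.CriticalPhenomena.Ising3DConformalLimit.Theorems.EtaBoundsTransfer
open scoped BigOperators

/-- **Scaling limit of the symbol of a heavy-tailed step law.**  For `q ≥ 0` summable on `ℤ³` with
tail profile `q(x)‖x‖₂^{3+α} − Ψ(x̂) → 0` (`0 < α < 2`, `Ψ` continuous on the sphere) and every
`κ ∈ ℝ³`, the sequence `N^α ∑_y q(y)(1 − cos((κ/N)·y))` converges as `N → ∞`. -/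
theorem symbol_scaling_limit {q : Site 3 → ℝ} {α : ℝ} (hα0 : 0 < α) (hα2 : α < 2)
    (hq0 : ∀ y, 0 ≤ q y) (hqs : Summable q)
    {Ψ : EuclideanSpace ℝ (Fin 3) → ℝ} (hΨc : ContinuousOn Ψ (Metric.sphere 0 1))
    (hT : Tendsto (fun x : Site 3 => q x * ‖siteVec x‖ ^ (3 + α) - Ψ (‖siteVec x‖⁻¹ • siteVec x))
      cofinite (𝓝 0))
    (κ : Fin 3 → ℝ) :
    ∃ L : ℝ, Tendsto (fun N : ℕ => (N : ℝ) ^ α *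
      ∑' y, q y * (1 - Real.cos (phase 3 ((N : ℝ)⁻¹ • κ) y))) atTop (𝓝 L) := by
  have hπ := Real.pi_pos
  set K := Set.pi Set.univ (fun _ : Fin 3 => Set.Icc (-π) π) with hK
  -- the upper envelope
  obtain ⟨C, hC0, hCq⟩ := upper_of_profile (r := 3 + α) (by linarith) hΨc hT
  -- the phase at scale `N`
  have hphase : ∀ (N : ℕ) (y : Site 3), phase 3 ((N : ℝ)⁻¹ • κ) y = (N : ℝ)⁻¹ * phase 3 κ y := by
    intro N y
    simp only [phase, Pi.smul_apply, smul_eq_mul, Finset.mul_sum]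
    exact Finset.sum_congr rfl fun i _ => by ring
  set sκ : ℝ := ∑ i, |κ i| with hsκ
  have hsκ0 : 0 ≤ sκ := Finset.sum_nonneg fun i _ => abs_nonneg _
  have hphase_le : ∀ y : Site 3, |phase 3 κ y| ≤ sκ * ‖y‖ := by
    intro y
    calc |phase 3 κ y| = |∑ i, κ i * (y i : ℝ)| := rfl
      _ ≤ ∑ i, |κ i * (y i : ℝ)| := Finset.abs_sum_le_sum_abs _ _
      _ ≤ ∑ i, |κ i| * ‖y‖ := Finset.sum_le_sum fun i _ => by
          rw [abs_mul]
          refine mul_le_mul_of_nonneg_left ?_ (abs_nonneg _)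
          have := norm_le_pi_norm y i; rwa [Int.norm_eq_abs] at this
      _ = sκ * ‖y‖ := by rw [Finset.sum_mul]
  -- elementary bounds on `1 - cos`
  have hcos1 : ∀ t : ℝ, 1 - Real.cos t ≤ t ^ 2 / 2 := fun t => by
    linarith [Real.one_sub_sq_div_two_le_cos (x := t)]
  have hcos2 : ∀ t : ℝ, 1 - Real.cos t ≤ 2 := fun t => by linarith [Real.neg_one_le_cos t]
  have hcos0 : ∀ t : ℝ, 0 ≤ 1 - Real.cos t := fun t => by linarith [Real.cos_le_one t]
  -- weights and the split `q = q₁ + q₂`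
  set w : ℕ → Site 3 → ℝ := fun N y => 1 - Real.cos (phase 3 ((N : ℝ)⁻¹ • κ) y) with hw
  have hw0 : ∀ N y, 0 ≤ w N y := fun N y => hcos0 _
  have hw2 : ∀ N y, w N y ≤ 2 := fun N y => hcos2 _
  set q₁ : Site 3 → ℝ := fun y => if y ∈ box 3 1 then q y else 0 with hq₁
  set q₂ : Site 3 → ℝ := fun y => if y ∈ box 3 1 then 0 else q y with hq₂
  have hq12 : ∀ y, q y = q₁ y + q₂ y := fun y => by
    simp only [hq₁, hq₂]; split_ifs <;> ring
  have hq₁0 : ∀ y, 0 ≤ q₁ y := fun y => by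
    simp only [hq₁]; split_ifs
    · exact hq0 y
    · exact le_rfl
  have hq₂0 : ∀ y, 0 ≤ q₂ y := fun y => by
    simp only [hq₂]; split_ifs
    · exact le_rfl
    · exact hq0 y
  have hq₁le : ∀ y, q₁ y ≤ q y := fun y => by
    simp only [hq₁]; split_ifs
    · exact le_rfl
    · exact hq0 y
  have hq₂le : ∀ y, q₂ y ≤ q y := fun y => by
    simp only [hq₂]; split_ifs
    · exact hq0 y
    · exact le_rfl
  have hq₁s : Summable q₁ := Summable.of_nonneg_of_le hq₁0 hq₁le hqs
  have hq₂s : Summable q₂ := Summable.of_nonneg_of_le hq₂0 hq₂le hqs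
  have hsw : ∀ (f : Site 3 → ℝ), (∀ y, 0 ≤ f y) → Summable f → ∀ N, Summable fun y => f y * w N y :=
    fun f hf0 hfs N => Summable.of_nonneg_of_le (fun y => mul_nonneg (hf0 y) (hw0 N y))
      (fun y => mul_le_mul_of_nonneg_left (hw2 N y) (hf0 y)) (hfs.mul_right 2)
  have hsplit : ∀ N, ∑' y, q y * w N y = ∑ y ∈ box 3 1, q y * w N y + ∑' y, q₂ y * w N y := by
    intro N
    calc ∑' y, q y * w N y = ∑' y, (q₁ y * w N y + q₂ y * w N y) :=
          tsum_congr fun y => by rw [hq12]; ring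
      _ = ∑' y, q₁ y * w N y + ∑' y, q₂ y * w N y := (hsw q₁ hq₁0 hq₁s N).tsum_add (hsw q₂ hq₂0 hq₂s N)
      _ = ∑ y ∈ box 3 1, q y * w N y + ∑' y, q₂ y * w N y := by
          congr 1
          rw [tsum_eq_sum (s := box 3 1) (fun y hy => by simp only [hq₁, if_neg hy, zero_mul])]
          exact Finset.sum_congr rfl fun y hy => by simp only [hq₁, if_pos hy]
  -- Part A: the finitely many sites of `Λ₁` contribute `o(1)`
  have hA : Tendsto (fun N : ℕ => (N : ℝ) ^ α * ∑ y ∈ box 3 1, q y * w N y) atTop (𝓝 0) := by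
    have h1 : Tendsto (fun N : ℕ => (N : ℝ) ^ (α - 2)) atTop (𝓝 0) := by
      have := (tendsto_rpow_neg_atTop (show 0 < 2 - α by linarith)).comp tendsto_natCast_atTop_atTop
      refine this.congr fun N => ?_
      simp only [Function.comp_apply]; rw [show -(2 - α) = α - 2 by ring]
    have hmain : Tendsto (fun N : ℕ => (N : ℝ) ^ (α - 2) * ∑ y ∈ box 3 1, q y * ((phase 3 κ y) ^ 2 / 2))
        atTop (𝓝 0) := by
      simpa using h1.mul_const (∑ y ∈ box 3 1, q y * ((phase 3 κ y) ^ 2 / 2))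
    refine squeeze_zero' (Eventually.of_forall fun N => mul_nonneg (Real.rpow_nonneg (Nat.cast_nonneg N) _)
      (Finset.sum_nonneg fun y _ => mul_nonneg (hq0 y) (hw0 N y))) ?_ hmain
    filter_upwards [eventually_ge_atTop 1] with N hN
    have hNr : (0 : ℝ) < N := by exact_mod_cast hN
    have hterm : ∀ y, q y * w N y ≤ q y * ((phase 3 κ y) ^ 2 / 2) * (N : ℝ) ^ (-(2 : ℝ)) := by
      intro y
      have h := hcos1 (phase 3 ((N : ℝ)⁻¹ • κ) y)
      rw [hphase] at h
      have h2 : ((N : ℝ)⁻¹ * phase 3 κ y) ^ 2 / 2 = (phase 3 κ y) ^ 2 / 2 * (N : ℝ) ^ (-(2 : ℝ)) := by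
        rw [Real.rpow_neg hNr.le, Real.rpow_two]; field_simp
      calc q y * w N y ≤ q y * (((N : ℝ)⁻¹ * phase 3 κ y) ^ 2 / 2) :=
            mul_le_mul_of_nonneg_left (by simpa only [hw, hphase] using h) (hq0 y)
        _ = q y * ((phase 3 κ y) ^ 2 / 2) * (N : ℝ) ^ (-(2 : ℝ)) := by rw [h2]; ring
    calc (N : ℝ) ^ α * ∑ y ∈ box 3 1, q y * w N y
        ≤ (N : ℝ) ^ α * ∑ y ∈ box 3 1, q y * ((phase 3 κ y) ^ 2 / 2) * (N : ℝ) ^ (-(2 : ℝ)) :=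
          mul_le_mul_of_nonneg_left (Finset.sum_le_sum fun y _ => hterm y) (Real.rpow_nonneg hNr.le _)
      _ = (N : ℝ) ^ (α - 2) * ∑ y ∈ box 3 1, q y * ((phase 3 κ y) ^ 2 / 2) := by
          rw [← Finset.sum_mul, show α - 2 = α + (-(2 : ℝ)) by ring, Real.rpow_add hNr]; ring
  -- Part B: the rest is the integral of a step function
  set G : ℕ → Site 3 → ℝ := fun N y => (N : ℝ) ^ (3 + α) * (q₂ y * w N y) with hG
  set Q : ℕ → (Fin 3 → ℝ) → ℝ := fun N z => G N (fun i => ⌊(N : ℝ) * z i⌋) with hQ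
  have hB : ∀ N : ℕ, 0 < N → (N : ℝ) ^ α * ∑' y, q₂ y * w N y = ∫ z, Q N z := by
    intro N hN
    have hNr : (0 : ℝ) < N := by exact_mod_cast hN
    have hGs : Summable (G N) := (hsw q₂ hq₂0 hq₂s N).mul_left _
    simp only [hQ]
    rw [integral_comp_floor hGs hN]
    simp only [hG]
    rw [tsum_mul_left, ← mul_assoc]
    congr 1
    rw [show (3 : ℝ) + α = α + (3 : ℕ) by push_cast; ring, Real.rpow_add hNr, Real.rpow_natCast]
    field_simp
  -- Part C: dominated convergence for `Q N`
  set Lκ : EuclideanSpace ℝ (Fin 3) → ℝ := fun v => ∑ i, κ i * v i with hLκ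
  have hLκc : Continuous Lκ := by
    simp only [hLκ]
    refine continuous_finsetSum _ fun i _ => continuous_const.mul ?_
    exact (EuclideanSpace.proj i).continuous
  set f : (Fin 3 → ℝ) → ℝ := fun z =>
    ‖(WithLp.toLp 2 z : EuclideanSpace ℝ (Fin 3))‖ ^ (-(3 + α)) *
      Ψ (‖(WithLp.toLp 2 z : EuclideanSpace ℝ (Fin 3))‖⁻¹ • (WithLp.toLp 2 z : EuclideanSpace ℝ (Fin 3))) *
      (1 - Real.cos (Lκ (WithLp.toLp 2 z))) with hf
  set bound : (Fin 3 → ℝ) → ℝ := fun z =>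
    (C * 2 ^ (3 + α) * (2 * sκ ^ 2)) * K.indicator (fun z => ∏ i, |z i| ^ (-((1 + α) / 3))) z
      + (C * 2 ^ (3 + α) * 2 * 2 ^ (3 + α)) * (1 + ‖z‖) ^ (-(3 + α)) with hbound
  have hbound_int : Integrable bound := integrable_symbolMajorant hα0 hα2 _ _
  have hind_nn : ∀ z, 0 ≤ K.indicator (fun z => ∏ i, |z i| ^ (-((1 + α) / 3))) z := by
    intro z
    by_cases hz : z ∈ K
    · rw [Set.indicator_of_mem hz]; exact Finset.prod_nonneg fun i _ => Real.rpow_nonneg (abs_nonneg _) _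
    · rw [Set.indicator_of_notMem hz]
  have hbound_nn : ∀ z, 0 ≤ bound z := fun z => by
    simp only [hbound]
    exact add_nonneg (mul_nonneg (by positivity) (hind_nn z)) (by positivity)
  have hQmeas : ∀ N, AEStronglyMeasurable (Q N) := fun N =>
    (measurable_comp_floor (G N) N).aestronglyMeasurable
  -- the pointwise bound
  have hQbound : ∀ N, ∀ᵐ z, ‖Q N z‖ ≤ bound z := by
    intro N
    filter_upwards [ae_forall_coord_ne_zero (d := 3)] with z hz0
    set y : Site 3 := fun i => ⌊(N : ℝ) * z i⌋ with hy
    have hQN : Q N z = (N : ℝ) ^ (3 + α) * (q₂ y * w N y) := rfl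
    by_cases hyb : y ∈ box 3 1
    · have : q₂ y = 0 := by simp only [hq₂, if_pos hyb]
      rw [hQN, this, zero_mul, mul_zero, norm_zero]
      exact hbound_nn z
    -- now `‖y‖ ≥ 2`, hence `N ≥ 1` and `z ≠ 0`
    have hy2 : (2 : ℝ) ≤ ‖y‖ := by
      rw [Site.norm_eq_supNorm]
      have : ¬ Site.supNorm y ≤ 1 := fun h => hyb (mem_box_iff_supNorm_le.2 h)
      exact_mod_cast (show 2 ≤ Site.supNorm y by omega)
    have hN : 0 < N := by
      by_contra h
      have hN0 : N = 0 := by omega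
      apply hyb
      have : y = 0 := by funext i; simp [hy, hN0]
      rw [this]; exact zero_mem_box 3 1
    have hNr : (0 : ℝ) < N := by exact_mod_cast hN
    have hfl1 := norm_floor_le (N := N) z
    have hfl2 := norm_le_norm_floor (N := N) z
    rw [← hy] at hfl1 hfl2
    have hz1 : 1 ≤ (N : ℝ) * ‖z‖ := by linarith
    have hzpos : 0 < ‖z‖ := by
      by_contra h
      have : ‖z‖ = 0 := le_antisymm (not_lt.1 h) (norm_nonneg _)
      rw [this, mul_zero] at hz1; linarith
    have hylo : (N : ℝ) * ‖z‖ / 2 ≤ ‖y‖ := by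
      rcases le_or_gt ((N : ℝ) * ‖z‖) 4 with h4 | h4
      · linarith
      · linarith
    have hyhi : ‖y‖ ≤ 2 * ((N : ℝ) * ‖z‖) := by linarith
    have hypos : 0 < ‖y‖ := by linarith
    have hy0 : y ≠ 0 := norm_pos_iff.1 hypos
    -- the bound on `q₂ y`
    have hqy : q₂ y ≤ C * ‖y‖ ^ (-(3 + α)) := by
      have : q₂ y = q y := by simp only [hq₂, if_neg hyb]
      rw [this]; exact hCq y hy0
    have hpow1 : ‖y‖ ^ (-(3 + α)) ≤ 2 ^ (3 + α) * ((N : ℝ) * ‖z‖) ^ (-(3 + α)) := by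
      have h := Real.rpow_le_rpow_of_nonpos (by positivity : 0 < (N : ℝ) * ‖z‖ / 2) hylo
        (by linarith : -(3 + α) ≤ 0)
      rw [Real.div_rpow (by positivity) (by norm_num), Real.rpow_neg (by norm_num : (0:ℝ) ≤ 2),
        div_inv_eq_mul, mul_comm] at h
      exact h
    -- `N^{3+α} (N‖z‖)^{-(3+α)} = ‖z‖^{-(3+α)}`
    have hscale : (N : ℝ) ^ (3 + α) * ((N : ℝ) * ‖z‖) ^ (-(3 + α)) = ‖z‖ ^ (-(3 + α)) := by
      rw [Real.mul_rpow hNr.le hzpos.le, Real.rpow_neg hNr.le, ← mul_assoc,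
        mul_inv_cancel₀ (Real.rpow_pos_of_pos hNr _).ne', one_mul]
    have hQle : Q N z ≤ C * 2 ^ (3 + α) * ‖z‖ ^ (-(3 + α)) * w N y := by
      rw [hQN]
      calc (N : ℝ) ^ (3 + α) * (q₂ y * w N y) ≤ (N : ℝ) ^ (3 + α) * ((C * ‖y‖ ^ (-(3 + α))) * w N y) := by
            gcongr
            exact hw0 N y
        _ ≤ (N : ℝ) ^ (3 + α) * ((C * (2 ^ (3 + α) * ((N : ℝ) * ‖z‖) ^ (-(3 + α)))) * w N y) := by
            gcongr
            exact hw0 N y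
        _ = C * 2 ^ (3 + α) * ((N : ℝ) ^ (3 + α) * ((N : ℝ) * ‖z‖) ^ (-(3 + α))) * w N y := by ring
        _ = C * 2 ^ (3 + α) * ‖z‖ ^ (-(3 + α)) * w N y := by rw [hscale]
    have hQnn : 0 ≤ Q N z := by
      rw [hQN]; exact mul_nonneg (Real.rpow_nonneg hNr.le _) (mul_nonneg (hq₂0 y) (hw0 N y))
    rw [Real.norm_eq_abs, abs_of_nonneg hQnn]
    refine hQle.trans ?_
    rcases le_or_gt ‖z‖ 1 with hz1' | hz1'
    · -- near the origin: `w ≤ 2 sκ² ‖z‖²` and the product majorant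
      have hwle : w N y ≤ 2 * sκ ^ 2 * ‖z‖ ^ 2 := by
        have h := hcos1 (phase 3 ((N : ℝ)⁻¹ • κ) y)
        rw [hphase] at h
        have hph : |(N : ℝ)⁻¹ * phase 3 κ y| ≤ sκ * (2 * ‖z‖) := by
          rw [abs_mul, abs_of_pos (inv_pos.2 hNr)]
          calc (N : ℝ)⁻¹ * |phase 3 κ y| ≤ (N : ℝ)⁻¹ * (sκ * ‖y‖) :=
                mul_le_mul_of_nonneg_left (hphase_le y) (inv_nonneg.2 hNr.le)
            _ ≤ (N : ℝ)⁻¹ * (sκ * (2 * ((N : ℝ) * ‖z‖))) := by gcongr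
            _ = sκ * (2 * ‖z‖) := by field_simp
        have hsq : ((N : ℝ)⁻¹ * phase 3 κ y) ^ 2 ≤ (sκ * (2 * ‖z‖)) ^ 2 := by
          rw [← sq_abs]; exact pow_le_pow_left₀ (abs_nonneg _) hph 2
        calc w N y = 1 - Real.cos ((N : ℝ)⁻¹ * phase 3 κ y) := by simp only [hw, hphase]
          _ ≤ ((N : ℝ)⁻¹ * phase 3 κ y) ^ 2 / 2 := h
          _ ≤ (sκ * (2 * ‖z‖)) ^ 2 / 2 := by gcongr
          _ = 2 * sκ ^ 2 * ‖z‖ ^ 2 := by ring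
      have hzK : z ∈ K := by
        rw [hK, Set.mem_pi]; intro i _
        have : |z i| ≤ ‖z‖ := by have := norm_le_pi_norm z i; rwa [Real.norm_eq_abs] at this
        rw [Set.mem_Icc, ← abs_le]; linarith [Real.pi_gt_three]
      have hprod : ‖z‖ ^ (-(1 + α)) ≤ ∏ i, |z i| ^ (-((1 + α) / 3)) := by
        have := norm_rpow_neg_le_prod (d := 3) (by norm_num) (by linarith : (0:ℝ) ≤ 1 + α) hz0
        simpa using this
      have hcomb : ‖z‖ ^ (-(3 + α)) * ‖z‖ ^ 2 = ‖z‖ ^ (-(1 + α)) := by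
        rw [← Real.rpow_two, ← Real.rpow_add hzpos]; congr 1; ring
      calc C * 2 ^ (3 + α) * ‖z‖ ^ (-(3 + α)) * w N y
          ≤ C * 2 ^ (3 + α) * ‖z‖ ^ (-(3 + α)) * (2 * sκ ^ 2 * ‖z‖ ^ 2) := by gcongr
        _ = C * 2 ^ (3 + α) * (2 * sκ ^ 2) * (‖z‖ ^ (-(3 + α)) * ‖z‖ ^ 2) := by ring
        _ = C * 2 ^ (3 + α) * (2 * sκ ^ 2) * ‖z‖ ^ (-(1 + α)) := by rw [hcomb]
        _ ≤ C * 2 ^ (3 + α) * (2 * sκ ^ 2) * ∏ i, |z i| ^ (-((1 + α) / 3)) := by gcongr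
        _ = C * 2 ^ (3 + α) * (2 * sκ ^ 2) * K.indicator (fun z => ∏ i, |z i| ^ (-((1 + α) / 3))) z := by
            rw [Set.indicator_of_mem hzK]
        _ ≤ bound z := by
            simp only [hbound]
            have : 0 ≤ (C * 2 ^ (3 + α) * 2 * 2 ^ (3 + α)) * (1 + ‖z‖) ^ (-(3 + α)) := by positivity
            linarith
    · -- far from the origin: `w ≤ 2` and the Japanese bracket
      have hjap : ‖z‖ ^ (-(3 + α)) ≤ 2 ^ (3 + α) * (1 + ‖z‖) ^ (-(3 + α)) := by
        have h1 : (1 + ‖z‖) / 2 ≤ ‖z‖ := by linarith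
        have h := Real.rpow_le_rpow_of_nonpos (by positivity : 0 < (1 + ‖z‖) / 2) h1 (by linarith : -(3 + α) ≤ 0)
        rw [Real.div_rpow (by positivity) (by norm_num), Real.rpow_neg (by norm_num : (0:ℝ) ≤ 2),
          div_inv_eq_mul, mul_comm] at h
        exact h
      calc C * 2 ^ (3 + α) * ‖z‖ ^ (-(3 + α)) * w N y
          ≤ C * 2 ^ (3 + α) * (2 ^ (3 + α) * (1 + ‖z‖) ^ (-(3 + α))) * 2 := by
            gcongr <;> first | exact hw0 N y | exact hw2 N y
        _ = (C * 2 ^ (3 + α) * 2 * 2 ^ (3 + α)) * (1 + ‖z‖) ^ (-(3 + α)) := by ring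
        _ ≤ bound z := by
            simp only [hbound]
            have : 0 ≤ (C * 2 ^ (3 + α) * (2 * sκ ^ 2)) *
                K.indicator (fun z => ∏ i, |z i| ^ (-((1 + α) / 3))) z :=
              mul_nonneg (by positivity) (hind_nn z)
            linarith
  -- the pointwise limit
  have hQlim : ∀ᵐ z, Tendsto (fun N => Q N z) atTop (𝓝 (f z)) := by
    filter_upwards [ae_forall_coord_ne_zero (d := 3)] with z hz0
    set x : EuclideanSpace ℝ (Fin 3) := WithLp.toLp 2 z with hx
    have hx0 : x ≠ 0 := by
      intro h
      have : z 0 = 0 := by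
        have := congrArg (fun v : EuclideanSpace ℝ (Fin 3) => v 0) h
        simpa [hx] using this
      exact hz0 0 this
    -- the approximants are `latticeApprox N⁻¹ x`
    have hfl : ∀ N : ℕ, ((fun i => ⌊(N : ℝ) * z i⌋) : Site 3) = latticeApprox ((N : ℝ)⁻¹) x := by
      intro N; funext i
      rw [latticeApprox_apply, div_inv_eq_mul, mul_comm]
    have hconv : Tendsto (fun N : ℕ => (N : ℝ)⁻¹ • siteVec (latticeApprox ((N : ℝ)⁻¹) x)) atTop (𝓝 x) :=
      tendsto_inv_smul_of_norm_sub_le fun N => norm_siteVec_latticeApprox_sub_le N x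
    have h1 : Tendsto (fun N : ℕ => (N : ℝ) ^ (3 + α) * q (latticeApprox ((N : ℝ)⁻¹) x)) atTop
        (𝓝 (‖x‖ ^ (-(3 + α)) * Ψ (‖x‖⁻¹ • x))) :=
      tendsto_rpow_mul_of_directional hT hΨc hconv hx0
    -- eventually the approximants leave the unit box, where `q₂ = q`
    have hev : ∀ᶠ N : ℕ in atTop, q₂ (latticeApprox ((N : ℝ)⁻¹) x) = q (latticeApprox ((N : ℝ)⁻¹) x) := by
      have hnorm := tendsto_norm_atTop_of_tendsto_inv_smul hconv hx0
      filter_upwards [hnorm.eventually_gt_atTop 2] with N hN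
      have hnot : latticeApprox ((N : ℝ)⁻¹) x ∉ box 3 1 := fun h =>
        absurd (norm_siteVec_le_two_of_mem_box h) (not_le.2 hN)
      simp only [hq₂, if_neg hnot]
    have h1' : Tendsto (fun N : ℕ => (N : ℝ) ^ (3 + α) * q₂ (latticeApprox ((N : ℝ)⁻¹) x)) atTop
        (𝓝 (‖x‖ ^ (-(3 + α)) * Ψ (‖x‖⁻¹ • x))) :=
      h1.congr' (by filter_upwards [hev] with N hN; rw [hN])
    -- the cosine factor
    have h2 : Tendsto (fun N : ℕ => w N (latticeApprox ((N : ℝ)⁻¹) x)) atTop (𝓝 (1 - Real.cos (Lκ x))) := by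
      have hph : ∀ N : ℕ, phase 3 ((N : ℝ)⁻¹ • κ) (latticeApprox ((N : ℝ)⁻¹) x)
          = Lκ ((N : ℝ)⁻¹ • siteVec (latticeApprox ((N : ℝ)⁻¹) x)) := by
        intro N
        simp only [phase, hLκ, Pi.smul_apply, smul_eq_mul, PiLp.smul_apply, siteVec_apply]
        exact Finset.sum_congr rfl fun i _ => by ring
      simp only [hw, hph]
      exact ((continuous_const.sub (Real.continuous_cos.comp hLκc)).tendsto x).comp hconv
    have h3 := h1'.mul h2
    have hQeq : ∀ N : ℕ, Q N z = (N : ℝ) ^ (3 + α) * q₂ (latticeApprox ((N : ℝ)⁻¹) x) *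
        w N (latticeApprox ((N : ℝ)⁻¹) x) := by
      intro N
      simp only [hQ, hG, hfl N]
      ring
    simp_rw [hQeq]
    have hfz : f z = ‖x‖ ^ (-(3 + α)) * Ψ (‖x‖⁻¹ • x) * (1 - Real.cos (Lκ x)) := rfl
    rw [hfz]
    exact h3
  -- dominated convergence
  have hDCT := tendsto_integral_of_dominated_convergence bound hQmeas hbound_int hQbound hQlim
  -- Part D: assemble
  refine ⟨0 + ∫ z, f z, ?_⟩
  have hsum := hA.add hDCT
  refine hsum.congr' ?_
  filter_upwards [eventually_gt_atTop 0] with N hN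
  rw [← hB N hN, ← mul_add, ← hsplit N]

end Summit.CriticalPhenomena.Ising3DConformalLimit.Theorems.SpineGlue

end
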